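import Mathlib.Analysis.SpecialFunctions.Pow.Real
import Mathlib.Analysis.SpecificLimits.Basic
import Literature.Analysis.FluidPDE.LagrangianLatticeCarrier
import Literature.Analysis.FluidPDE.PassiveVectorTensor
import HarnessLib

/-!
# K1L `LagrangianRenormalisationStep` (stmt-AnomalousDissipation-24912), registered line `birth` (v9):
the content of the registered stub `stub_cascadeT` — the chain of one-level energy-drop ratios telescopes to the cascade

Helper file for the crux `LagrangianRenormalisationStep` of route `SolenoidalFractalHomogenisation`
(cell `ad-ideate`; registered skeleton `HOME/ad-ideate-p1/r17/LagrangianRenormalisationStep_birth_v9_lit_tree.lean`,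
sha16 `44fd45a3f04a315f`).  The skeleton's vocabulary (`VF`, `IsDatum`, `InClass`, `TSol`, `drop`, `Chain`, `Cascade`)
is local to the skeleton and not importable, so the result is stated

* once ABSTRACTLY (`cascade_of_chain_abstract`): for ANY solution predicate `Sol m 𝔸 w₀ u`, window predicate `NI`,
  isotropic embedding `iso`, data classes `Dat`/`Cls`, drop functional `dr` and filter `L`, the "chain" package
  (existence one level down + two-sided a.e. drop RATIOS `1 ± C ρ_m^σ`, `ρ_m = N_m / N_{m+1}`) along a template with
  `2 N_m ≤ N_{m+1}` and `N_m² ≤ N_{m+1}` gives the "cascade" package (a base level `m⋆`, `θ = 1/2`, and for every top-level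
  solution SOME base-level solution dropping at most `θ⁻¹ ×` as much) — the proof is Armstrong–Vicol's telescoping
  (arXiv:2305.05048 §5.4): raise `m⋆` until `Σ_{m ≥ m⋆} C ρ_m^σ ≤ 1/2` (`ρ_m ≤ 1/N_m ≤ 2^{-m}`), thread existence downwards,
  compound the lower ratios additively (`(1 - a)(1 - b) ≥ 1 - a - b` for `a, b ≥ 0`), intersect finitely many a.e. sets;
* once CONCRETELY (`cascade_of_chain`) for a Lagrangian lattice carrier `E` with the skeleton's definitions unfolded over the
  tree constants (`Torus.IsWeakTensorPassiveVectorOn 0 1 𝔸 (E.partialSum m)`, `Torus.NearIso`, `Torus.isoVisc`,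
  `Torus.vectorL2Sq w₀ - ∫ ‖u t x‖²`, `ae (volume.restrict (Ioo (1/2) 1))`), so that in the skeleton's namespace
  `theorem stub_cascadeT … := by intro k E hP hsq hCh; exact cascade_of_chain E hP hsq hCh` closes the stub by `exact` (delta).

No definitions, no named facts, no sorry.  Prover seat `ad-solenoidal-k2r-lowerlaw-p1` g5 (2026-08-28), `--supports stmt-AnomalousDissipation-24912`.
-/

set_option linter.dupNamespace false

namespace Summit.AnomalousDissipation.AnomalousDissipation.Theorems.SolenoidalFractalHomogenisation.LagrangianRenormalisationStep

noncomputable section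

open MeasureTheory Set Filter
open scoped NNReal ENNReal
open Literature.Analysis Literature.Analysis.FluidPDE Literature.Analysis.FunctionSpaces

/-! ## Real-arithmetic helpers -/

/-- A template with `0 < N_m`, `2 N_m ≤ N_{m+1}` grows at least geometrically: `2^m ≤ N_m`. -/
theorem two_pow_le_template {N : ℕ → ℕ} (hN : ∀ m, 0 < N m) (h2 : ∀ m, 2 * N m ≤ N (m + 1)) (m : ℕ) :
    (2 : ℝ) ^ m ≤ N m := by
  induction m with
  | zero => simpa using (Nat.one_le_iff_ne_zero.mpr (hN 0).ne' : 1 ≤ N 0)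
  | succ m ih =>
    have h := h2 m
    have h' : (2 : ℝ) * N m ≤ N (m + 1) := by exact_mod_cast h
    calc (2 : ℝ) ^ (m + 1) = 2 * 2 ^ m := by ring
      _ ≤ 2 * (N m : ℝ) := by linarith
      _ ≤ N (m + 1) := h'

/-- Along a super-geometric template (`N_m² ≤ N_{m+1}`) with `2^m ≤ N_m`, the scale ratio `ρ_m = N_m / N_{m+1}` is at most `2^{-m}`. -/
theorem ratio_le_half_pow {N : ℕ → ℕ} (hN : ∀ m, 0 < N m) (h2 : ∀ m, 2 * N m ≤ N (m + 1))
    (hsq : ∀ m, N m ^ 2 ≤ N (m + 1)) (m : ℕ) :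
    (N m : ℝ) / N (m + 1) ≤ (1 / 2 : ℝ) ^ m := by
  have hNm : (0 : ℝ) < N m := by exact_mod_cast hN m
  have hsq' : ((N m : ℝ)) ^ 2 ≤ N (m + 1) := by exact_mod_cast hsq m
  calc (N m : ℝ) / N (m + 1) ≤ (N m : ℝ) / (N m : ℝ) ^ 2 :=
        div_le_div_of_nonneg_left hNm.le (by positivity) hsq'
    _ = 1 / (N m : ℝ) := by field_simp
    _ ≤ 1 / (2 : ℝ) ^ m := one_div_le_one_div_of_le (by positivity) (two_pow_le_template hN h2 m)
    _ = (1 / 2 : ℝ) ^ m := by rw [one_div_pow]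

/-! ## The abstract telescoping lemma -/

/-- **Chain ⇒ cascade, abstractly** (Armstrong–Vicol's telescoping, arXiv:2305.05048 §5.4, in the shape of the registered
K1L stub `stub_cascadeT`).  `Sol m 𝔸 w₀ u`: "`u` solves the level-`m` problem with tensor `𝔸` from the datum `w₀`";
`NI 𝔸 lo hi`: a coercivity window; `iso ν`: the isotropic tensor; `Dat`, `Cls R`: the data classes; `dr w₀ u t`: the energy
dropped by time `t`; `L`: the filter ("for a.e. `t ∈ (1/2, 1)`").  From the chain package — a uniform window, existence one level
down and the two-sided drop ratios `1 ± C (N_m/N_{m+1})^σ` for every pair of solutions at consecutive levels — along a template with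
`2 N_m ≤ N_{m+1}`, `N_m² ≤ N_{m+1}`, every top-level solution (`j ≥ m⋆ + 1`) drops at least half of what SOME solution of the
window-confined level-`m⋆` problem with the same datum drops. -/
theorem cascade_of_chain_abstract {V A : Type*}
    (Sol : ℕ → A → V → (ℝ → V) → Prop) (NI : A → ℝ → ℝ → Prop) (iso : ℝ → A)
    (Dat : V → Prop) (Cls : ℝ≥0 → V → Prop) (kbar : ℕ → ℝ) (N : ℕ → ℕ) (dr : V → (ℝ → V) → ℝ → ℝ)
    (L : Filter ℝ)
    (hN : ∀ m, 0 < N m) (h2 : ∀ m, 2 * N m ≤ N (m + 1)) (hsq : ∀ m, N m ^ 2 ≤ N (m + 1))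
    (hCh : ∃ alo > (0:ℝ), ∃ ahi : ℝ, ∃ C > (0:ℝ), ∃ σ > (0:ℝ), ∀ R : ℝ≥0, ∃ mstar : ℕ, ∀ j, mstar ≤ j →
      ∃ 𝔸 : ℕ → A, 𝔸 j = iso (kbar j) ∧
        (∀ m, mstar ≤ m → m ≤ j → NI (𝔸 m) (kbar m * alo) (kbar m * ahi)) ∧
        ∀ m, mstar ≤ m → m < j → ∀ w₀ : V, Dat w₀ → Cls R w₀ →
          (∃ v, Sol m (𝔸 m) w₀ v) ∧
          ∀ u v : ℝ → V, Sol (m + 1) (𝔸 (m + 1)) w₀ u → Sol m (𝔸 m) w₀ v →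
            ∀ᶠ t in L,
              0 ≤ dr w₀ v t ∧
              (1 - C * ((N m : ℝ) / N (m + 1)) ^ σ) * dr w₀ v t ≤ dr w₀ u t ∧
              dr w₀ u t ≤ (1 + C * ((N m : ℝ) / N (m + 1)) ^ σ) * dr w₀ v t) :
    ∃ a > (0:ℝ), ∀ R : ℝ≥0, ∃ mstar : ℕ, ∃ θ > (0:ℝ), ∃ j₁ : ℕ, ∀ j ≥ j₁,
      ∃ 𝔸s : A, ∃ hi : ℝ, NI 𝔸s (kbar mstar * a) hi ∧
        ∀ (w₀ : V) (u : ℝ → V), Dat w₀ → Cls R w₀ → Sol j (iso (kbar j)) w₀ u →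
          ∃ v, Sol mstar 𝔸s w₀ v ∧ ∀ᶠ t in L, θ * dr w₀ v t ≤ dr w₀ u t := by
  obtain ⟨alo, halo, ahi, C, hC, σ, hσ, hR⟩ := hCh
  refine ⟨alo, halo, fun R => ?_⟩
  obtain ⟨mstar, hm⟩ := hR R
  -- the one-level error `x m = C ρ_m^σ` is dominated by the geometric sequence `C r^m`, `r = (1/2)^σ < 1`
  set x : ℕ → ℝ := fun m => C * ((N m : ℝ) / N (m + 1)) ^ σ with hx_def
  set r : ℝ := (1 / 2 : ℝ) ^ σ with hr_def
  have hr0 : 0 < r := Real.rpow_pos_of_pos (by norm_num) σ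
  have hr1 : r < 1 := Real.rpow_lt_one (by norm_num) (by norm_num) hσ
  have hρ0 : ∀ m, 0 ≤ (N m : ℝ) / N (m + 1) := fun m => by positivity
  have hx0 : ∀ m, 0 ≤ x m := fun m => by
    simp only [hx_def]
    exact mul_nonneg hC.le (Real.rpow_nonneg (hρ0 m) σ)
  have hxr : ∀ m, x m ≤ C * r ^ m := fun m => by
    simp only [hx_def, hr_def]
    refine mul_le_mul_of_nonneg_left ?_ hC.le
    calc ((N m : ℝ) / N (m + 1)) ^ σ ≤ ((1 / 2 : ℝ) ^ m) ^ σ :=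
          Real.rpow_le_rpow (hρ0 m) (ratio_le_half_pow hN h2 hsq m) hσ.le
      _ = ((1 / 2 : ℝ) ^ σ) ^ m := by
          rw [← Real.rpow_natCast, ← Real.rpow_mul (by norm_num), mul_comm, Real.rpow_mul (by norm_num),
            Real.rpow_natCast]
  -- raise the base level until the tail of the errors is at most `1/2`
  obtain ⟨M₀, hM₀⟩ : ∃ M₀ : ℕ, C * r ^ M₀ ≤ (1 - r) / 2 := by
    have ht : Tendsto (fun n : ℕ => C * r ^ n) atTop (nhds (C * 0)) :=
      (tendsto_pow_atTop_nhds_zero_of_lt_one hr0.le hr1).const_mul C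
    rw [mul_zero] at ht
    have hpos : (0 : ℝ) < (1 - r) / 2 := by linarith
    exact (ht.eventually (ge_mem_nhds hpos)).exists
  set M : ℕ := max mstar M₀ with hM_def
  have hMm : mstar ≤ M := le_max_left _ _
  have hMM₀ : M₀ ≤ M := le_max_right _ _
  -- every error from level `M` on is at most `1/2`, and their partial sums stay below `1/2`
  have hx_half : ∀ m, M ≤ m → x m ≤ 1 / 2 := fun m hMle => by
    have h1 : r ^ m ≤ r ^ M₀ := pow_le_pow_of_le_one hr0.le hr1.le (le_trans hMM₀ hMle)
    have := hxr m
    nlinarith [hC]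
  have hsum_half : ∀ n, ∑ i ∈ Finset.range n, x (M + i) ≤ 1 / 2 := fun n => by
    have hgeom : ∑ i ∈ Finset.range n, r ^ i ≤ (1 - r)⁻¹ := by
      have hs : Summable (fun i : ℕ => r ^ i) := summable_geometric_of_lt_one hr0.le hr1
      calc ∑ i ∈ Finset.range n, r ^ i ≤ ∑' i : ℕ, r ^ i :=
            hs.sum_le_tsum (Finset.range n) (fun i _ => pow_nonneg hr0.le i)
        _ = (1 - r)⁻¹ := tsum_geometric_of_lt_one hr0.le hr1
    calc ∑ i ∈ Finset.range n, x (M + i) ≤ ∑ i ∈ Finset.range n, C * r ^ M * r ^ i := by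
          refine Finset.sum_le_sum fun i _ => ?_
          calc x (M + i) ≤ C * r ^ (M + i) := hxr (M + i)
            _ = C * r ^ M * r ^ i := by rw [pow_add, mul_assoc]
      _ = C * r ^ M * ∑ i ∈ Finset.range n, r ^ i := by rw [Finset.mul_sum]
      _ ≤ C * r ^ M * (1 - r)⁻¹ := mul_le_mul_of_nonneg_left hgeom (by positivity)
      _ ≤ C * r ^ M₀ * (1 - r)⁻¹ := by
          have h1 : r ^ M ≤ r ^ M₀ := pow_le_pow_of_le_one hr0.le hr1.le hMM₀
          have h2' : 0 < (1 - r)⁻¹ := inv_pos.mpr (by linarith)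
          exact mul_le_mul_of_nonneg_right (mul_le_mul_of_nonneg_left h1 hC.le) h2'.le
      _ ≤ (1 - r) / 2 * (1 - r)⁻¹ := mul_le_mul_of_nonneg_right hM₀ (inv_pos.mpr (by linarith)).le
      _ = 1 / 2 := by
          have hne : (1 - r) ≠ 0 := ne_of_gt (by linarith)
          calc (1 - r) / 2 * (1 - r)⁻¹ = ((1 - r) * (1 - r)⁻¹) / 2 := by ring
            _ = 1 / 2 := by rw [mul_inv_cancel₀ hne]
  refine ⟨M, 1 / 2, by norm_num, M + 1, fun j hj => ?_⟩
  obtain ⟨𝔸, h𝔸j, hNI, hstep⟩ := hm j (le_trans hMm (by omega))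
  refine ⟨𝔸 M, kbar M * ahi, hNI M hMm (by omega), fun w₀ u hD hCl hu => ?_⟩
  -- descending induction: from a solution `n+1` levels above `m` to some level-`m` solution, compounding the lower ratios
  have key : ∀ n m, M ≤ m → m + (n + 1) ≤ j → ∀ u' : ℝ → V, Sol (m + (n + 1)) (𝔸 (m + (n + 1))) w₀ u' →
      ∃ v, Sol m (𝔸 m) w₀ v ∧ ∀ᶠ t in L,
        0 ≤ dr w₀ v t ∧ (1 - ∑ i ∈ Finset.range (n + 1), x (m + i)) * dr w₀ v t ≤ dr w₀ u' t := by
    intro n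
    induction n with
    | zero =>
      intro m hMle hmj u' hu'
      obtain ⟨⟨v, hv⟩, hpair⟩ := hstep m (le_trans hMm hMle) (by omega) w₀ hD hCl
      refine ⟨v, hv, ?_⟩
      have h := hpair u' v (by simpa using hu') hv
      refine h.mono fun t ht => ⟨ht.1, ?_⟩
      simpa [hx_def] using ht.2.1
    | succ n ih =>
      intro m hMle hmj u' hu'
      -- one chain step at level `m + (n+1)`
      have e : m + (n + 1 + 1) = m + (n + 1) + 1 := by omega
      rw [e] at hu'
      obtain ⟨⟨v', hv'⟩, hpair⟩ := hstep (m + (n + 1)) (le_trans (le_trans hMm hMle) (by omega)) (by omega) w₀ hD hCl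
      have hone := hpair u' v' hu' hv'
      -- the induction hypothesis from `v'`
      obtain ⟨v, hv, hih⟩ := ih m hMle (by omega) v' hv'
      refine ⟨v, hv, (hone.and hih).mono fun t ht => ⟨ht.2.1, ?_⟩⟩
      obtain ⟨⟨_, hlow, _⟩, hvnn, hsumle⟩ := ht
      have hxle : x (m + (n + 1)) ≤ 1 / 2 := hx_half _ (by omega)
      have hxnn : 0 ≤ x (m + (n + 1)) := hx0 _
      have hfac : 0 ≤ 1 - x (m + (n + 1)) := by linarith
      have hSnn : 0 ≤ ∑ i ∈ Finset.range (n + 1), x (m + i) := Finset.sum_nonneg fun i _ => hx0 _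
      have hlow' : (1 - x (m + (n + 1))) * dr w₀ v' t ≤ dr w₀ u' t := by simpa [hx_def] using hlow
      have hmid : (1 - x (m + (n + 1))) * ((1 - ∑ i ∈ Finset.range (n + 1), x (m + i)) * dr w₀ v t) ≤
          (1 - x (m + (n + 1))) * dr w₀ v' t := mul_le_mul_of_nonneg_left hsumle hfac
      rw [Finset.sum_range_succ]
      have hcross : 0 ≤ x (m + (n + 1)) * (∑ i ∈ Finset.range (n + 1), x (m + i)) * dr w₀ v t :=
        mul_nonneg (mul_nonneg hxnn hSnn) hvnn
      nlinarith [hmid, hlow', hcross]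
  -- apply it between the top level `j = M + (n+1)` and the base level `M`
  obtain ⟨n, rfl⟩ : ∃ n, j = M + (n + 1) := ⟨j - M - 1, by omega⟩
  rw [← h𝔸j] at hu
  obtain ⟨v, hv, hfin⟩ := key n M le_rfl le_rfl u hu
  refine ⟨v, hv, hfin.mono fun t ht => ?_⟩
  obtain ⟨hvnn, hsumle⟩ := ht
  have hP : 1 / 2 ≤ 1 - ∑ i ∈ Finset.range (n + 1), x (M + i) := by
    have hS := hsum_half (n + 1)
    linarith
  calc 1 / 2 * dr w₀ v t ≤ (1 - ∑ i ∈ Finset.range (n + 1), x (M + i)) * dr w₀ v t :=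
        mul_le_mul_of_nonneg_right hP hvnn
    _ ≤ dr w₀ u t := hsumle

/-! ## The concrete form for a Lagrangian lattice carrier (the registered stub, unfolded) -/

/-- **`stub_cascadeT` of the K1L birth skeleton, unfolded over tree constants** (Armstrong–Vicol telescoping, arXiv:2305.05048 §5.4):
for an L-permissible Lagrangian lattice carrier `E` on a super-geometric template (`N_m² ≤ N_{m+1}`), the renormalised tensor CHAIN
(a uniform coercivity window `kbar_m·[alo, ahi]`, existence one level down and two-sided a.e. energy-drop ratios `1 ± C(N_m/N_{m+1})^σ`
on `(1/2, 1)` between weak tensor-class solutions along the partial sums `E.partialSum (m+1)`, `E.partialSum m` with the same `H¹`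
mean-zero divergence-free datum of class `R`) yields the CASCADE: a base level `m⋆`, `θ > 0` and `j₁` such that every top-level
solution (`j ≥ j₁`, isotropic viscosity `kbar_j`) drops by a.e. `t ∈ (1/2,1)` at least `θ ×` what some solution of a window-confined
level-`m⋆` problem with the same datum drops.  In the skeleton's namespace,
`theorem stub_cascadeT … := by intro k E hP hsq hCh; exact cascade_of_chain E hP hsq hCh`. -/
theorem cascade_of_chain {k : ℕ} (E : LatticeShear.LagrangianLatticeCarrier k) (hP : E.LPermissible)
    (hsq : ∀ m, E.N m ^ 2 ≤ E.N (m + 1))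
    (hCh : ∃ alo > (0:ℝ), ∃ ahi : ℝ, ∃ C > (0:ℝ), ∃ σ > (0:ℝ), ∀ R : ℝ≥0, ∃ mstar : ℕ, ∀ j, mstar ≤ j →
      ∃ 𝔸 : ℕ → Torus.Visc4 (Fin 3), 𝔸 j = Torus.isoVisc (E.kbar j) ∧
        (∀ m, mstar ≤ m → m ≤ j → Torus.NearIso (𝔸 m) (E.kbar m * alo) (E.kbar m * ahi)) ∧
        ∀ m, mstar ≤ m → m < j → ∀ w₀ : UnitAddTorus (Fin 3) → EuclideanSpace ℝ (Fin 3),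
          (FunctionSpaces.Torus.MemSobolev 1 (FunctionSpaces.EuclideanSpace.complexify ∘ w₀) ∧
            FunctionSpaces.Torus.HasZeroMean w₀ ∧ FunctionSpaces.Torus.IsWeaklyDivFree w₀) →
          FunctionSpaces.Torus.eGradNormSq w₀ ≤ (R : ℝ≥0∞) * ENNReal.ofReal (Torus.vectorL2Sq w₀) →
          (∃ v, Torus.IsWeakTensorPassiveVectorOn 0 1 (𝔸 m) (E.partialSum m) w₀ v) ∧
          ∀ u v : ℝ → UnitAddTorus (Fin 3) → EuclideanSpace ℝ (Fin 3),
            Torus.IsWeakTensorPassiveVectorOn 0 1 (𝔸 (m + 1)) (E.partialSum (m + 1)) w₀ u →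
            Torus.IsWeakTensorPassiveVectorOn 0 1 (𝔸 m) (E.partialSum m) w₀ v →
            ∀ᵐ t ∂(volume.restrict (Ioo (1/2 : ℝ) 1)),
              0 ≤ Torus.vectorL2Sq w₀ - ∫ x, ‖v t x‖ ^ 2 ∧
              (1 - C * ((E.N m : ℝ) / E.N (m + 1)) ^ σ) * (Torus.vectorL2Sq w₀ - ∫ x, ‖v t x‖ ^ 2) ≤
                Torus.vectorL2Sq w₀ - ∫ x, ‖u t x‖ ^ 2 ∧
              Torus.vectorL2Sq w₀ - ∫ x, ‖u t x‖ ^ 2 ≤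
                (1 + C * ((E.N m : ℝ) / E.N (m + 1)) ^ σ) * (Torus.vectorL2Sq w₀ - ∫ x, ‖v t x‖ ^ 2)) :
    ∃ a > (0:ℝ), ∀ R : ℝ≥0, ∃ mstar : ℕ, ∃ θ > (0:ℝ), ∃ j₁ : ℕ, ∀ j ≥ j₁,
      ∃ 𝔸s : Torus.Visc4 (Fin 3), ∃ hi : ℝ, Torus.NearIso 𝔸s (E.kbar mstar * a) hi ∧
        ∀ (w₀ : UnitAddTorus (Fin 3) → EuclideanSpace ℝ (Fin 3)) (u : ℝ → UnitAddTorus (Fin 3) → EuclideanSpace ℝ (Fin 3)),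
          (FunctionSpaces.Torus.MemSobolev 1 (FunctionSpaces.EuclideanSpace.complexify ∘ w₀) ∧
            FunctionSpaces.Torus.HasZeroMean w₀ ∧ FunctionSpaces.Torus.IsWeaklyDivFree w₀) →
          FunctionSpaces.Torus.eGradNormSq w₀ ≤ (R : ℝ≥0∞) * ENNReal.ofReal (Torus.vectorL2Sq w₀) →
          Torus.IsWeakTensorPassiveVectorOn 0 1 (Torus.isoVisc (E.kbar j)) (E.partialSum j) w₀ u →
          ∃ v, Torus.IsWeakTensorPassiveVectorOn 0 1 𝔸s (E.partialSum mstar) w₀ v ∧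
            ∀ᵐ t ∂(volume.restrict (Ioo (1/2 : ℝ) 1)),
              θ * (Torus.vectorL2Sq w₀ - ∫ x, ‖v t x‖ ^ 2) ≤ Torus.vectorL2Sq w₀ - ∫ x, ‖u t x‖ ^ 2 :=
  cascade_of_chain_abstract
    (fun m 𝔸 w₀ u => Torus.IsWeakTensorPassiveVectorOn 0 1 𝔸 (E.partialSum m) w₀ u)
    Torus.NearIso Torus.isoVisc
    (fun w₀ => FunctionSpaces.Torus.MemSobolev 1 (FunctionSpaces.EuclideanSpace.complexify ∘ w₀) ∧
      FunctionSpaces.Torus.HasZeroMean w₀ ∧ FunctionSpaces.Torus.IsWeaklyDivFree w₀)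
    (fun R w₀ => FunctionSpaces.Torus.eGradNormSq w₀ ≤ (R : ℝ≥0∞) * ENNReal.ofReal (Torus.vectorL2Sq w₀))
    E.kbar E.N (fun w₀ u t => Torus.vectorL2Sq w₀ - ∫ x, ‖u t x‖ ^ 2)
    (ae (volume.restrict (Ioo (1/2 : ℝ) 1)))
    E.N_pos hP.permissible.2.2.1 hsq hCh

end

end Summit.AnomalousDissipation.AnomalousDissipation.Theorems.SolenoidalFractalHomogenisation.LagrangianRenormalisationStep
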